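import Mathlib
import HarnessLib
import Summits.HubbardSuperconductivity.HubbardSuperconductivity.Theorems.KLProgrammeC4aPPKernelTrueSignedDeriv
import Summits.HubbardSuperconductivity.HubbardSuperconductivity.Theorems.KLProgrammeC4aPPKernelTrueNumeratorD3Bounds

/-!
# Route `KLProgramme` — crux C4a, S3 brick (B4) «(B4)-UMK1», «(U1)-M-LAW» kernel side: the SECOND derivative of the signed kernel `N(e,u)/(e+u)` —
# `|∂ᵤ²[N/(e+u)]| ≤ C·(max e |u|)⁻³` near the anti-diagonal (split-free, via `∂ᵤ³N`) and away from it (support condition), plus the near-shell all-`u` forms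

Cell `gate-hubbard-kl`, seat hubbard-kl-k3c3-p1 (g17; row «δμ-flow with klAngularMean constant piece»).  One order above `…C4aPPKernelTrueSignedDeriv` (g15); kernel rows for
k3c3-p3's «(U1)-M-LAW» (pen (R384)(A)(a); 5b-M `…C4aPreCausticLevelLineMiddle`, binders `hK1 : |∂ᵤK| ≤ 1/max(e,|u|)²`, `hK2 : |∂ᵤ²K| ≤ 1/max(e,|u|)³`).  On the
punctured line `e + u ≠ 0` the signed kernel `K(u) = N(e,u)/(e+u)` has
`K″(u) = ∂ᵤ²N/(e+u) − 2∂ᵤN/(e+u)² + 2N/(e+u)³ = ψ₂(u)/(e+u)³`, `ψ₂ = ∂ᵤ²N·(e+u)² − 2∂ᵤN·(e+u) + 2N`, `ψ₂(−e) = 0`, `ψ₂′(v) = ∂ᵤ³N(e,v)·(e+v)²`.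
* §1 `hasDerivAt_trueKernelDu_signed` (the formula for `K″` on `e+u ≠ 0`);
* §2 **`abs_trueKernelDuu_signed_near_le`** (`0 < e`, `e+u ≠ 0`, `|e+u| ≤ M/2`, `M = max e |u|`): `|K″(u)| ≤ C₃·M⁻³`, `C₃ = 256B₃+768B₂+2496B₁+1512` — NO split,
  mean value for `ψ₂` with `|∂ᵤ³N| ≤ C₃/M³` on the segment (`…TrueNumeratorD3Bounds`);
* §3 **`abs_trueKernelDuu_signed_far_le`** (`M/2 ≤ |e+u|`, support `c·e ≤ |u|`, `0 < c ≤ 1`): `|K″(u)| ≤ ((32B₂+48B₁+66)/c² + (48B₁+36)/c + 16)·M⁻³`;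
* §4 **`abs_trueKernelDuu_signed_le_inv_max_cube`** (both regimes, support condition);
* §5 the NEAR-SHELL ALL-`u` forms (no support condition; loop level `0 < e ≤ K·Λ`, `1 ≤ K`): **`abs_trueKernelDu_signed_le_of_le_mul`**
  (`|K′| ≤ (64B₂+120B₁+158+(12B₁+5)K)·M⁻²`) and **`abs_trueKernelDuu_signed_le_of_le_mul`** (`|K″| ≤ (C₃ + 128B₂+288B₁+368 + (32B₂+48B₁+60)K² + (48B₁+20)K)·M⁻³`)
  — the comparable-levels piece `M` of the smooth-floor partition is alive at `|u| ≪ e` only when `e ≲ lo ≤ Λ`, where the uniform gradient bounds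
  `|∂ᵤN| ≤ (6B₁+5/2)/Λ`, `|∂ᵤ²N| ≤ (16B₂+24B₁+30)/Λ²` pay `1/Λ ≤ K/e`.
Honest reading: the single point `u = −e` is excluded here (the product form `ppTrueKernel` inherits the bounds there by continuity of its own derivatives —
`…C4aPPKernelTrueKernelD2`).  Pure real analysis; nothing asserts (C), K3, the window or superconductivity.
References: BGM 2006 §2.4 (2.36) [cite: BenfattoGiulianiMastropietro2006]; Salmhofer 1999 §4.2.5 [cite: Salmhofer1999].
-/

noncomputable section

namespace Summit.HubbardSuperconductivity.HubbardSuperconductivity.Theorems.C4a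

set_option linter.dupNamespace false -- summit = problem name (single-conjunct summit), D-0017

open Real Filter Set
open scoped Topology
open Literature.MathematicalPhysics.QuantumLattice Literature.Analysis.SpecialFunctions

/-! ## §1 The second derivative of the signed kernel off the anti-diagonal -/

/-- `d/du[∂ᵤN/(e+u) − N/(e+u)²] = ∂ᵤ²N/(e+u) − 2∂ᵤN/(e+u)² + 2N/(e+u)³` (`e + u ≠ 0`). [cite: BenfattoGiulianiMastropietro2006, §2.4 (2.36)] -/
theorem hasDerivAt_trueKernelDu_signed {β Λ : ℝ} (hβ : 0 < β) (hΛ : 0 < Λ) {B₁ B₂ : ℝ} (hB₁ : ∀ x, |deriv salmhoferCutoff x| ≤ B₁)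
    (hB₂ : ∀ x, |deriv (deriv salmhoferCutoff) x| ≤ B₂) {e u : ℝ} (hs : e + u ≠ 0) :
    HasDerivAt (fun v : ℝ => ppTrueNumeratorDu β Λ e v / (e + v) - ppTrueNumerator β Λ e v / (e + v) ^ 2)
      (ppTrueNumeratorDuu β Λ e u / (e + u) - 2 * ppTrueNumeratorDu β Λ e u / (e + u) ^ 2 + 2 * ppTrueNumerator β Λ e u / (e + u) ^ 3) u := by
  have hN := hasDerivAt_ppTrueNumerator_u hβ hΛ hB₁ e u
  have hN' := hasDerivAt_ppTrueNumeratorDu_u hβ hΛ hB₁ hB₂ e u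
  have hD : HasDerivAt (fun v : ℝ => e + v) 1 u := (hasDerivAt_id u).const_add e
  have hD2 : HasDerivAt (fun v : ℝ => (e + v) ^ 2) (2 * (e + u) * 1) u := by
    have h0 := hD.pow 2
    refine h0.congr_deriv ?_
    simp
  have h := (hN'.div hD hs).sub (hN.div hD2 (pow_ne_zero 2 hs))
  refine h.congr_deriv ?_
  field_simp
  ring

/-! ## §2 Near the anti-diagonal: no split needed -/

/-- **THE SIGNED SECOND-DERIVATIVE ENVELOPE NEAR `u = −e`.**  `0 < β`, `0 < Λ`, `|χ′| ≤ B₁`, `|χ″| ≤ B₂`, `|χ‴| ≤ B₃`, `0 < e`, `e + u ≠ 0`,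
`|e+u| ≤ max(e,|u|)/2`: `|K″(u)| ≤ (256B₃+768B₂+2496B₁+1512)·(max e |u|)⁻¹³`. [cite: BenfattoGiulianiMastropietro2006, §2.4 (2.36)] -/
theorem abs_trueKernelDuu_signed_near_le {β Λ : ℝ} (hβ : 0 < β) (hΛ : 0 < Λ) {B₁ B₂ B₃ : ℝ} (hB₁ : ∀ x, |deriv salmhoferCutoff x| ≤ B₁)
    (hB₂ : ∀ x, |deriv (deriv salmhoferCutoff) x| ≤ B₂) (hB₃ : ∀ x, |deriv (deriv (deriv salmhoferCutoff)) x| ≤ B₃) {e u : ℝ} (he : 0 < e) (hs : e + u ≠ 0)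
    (hsmall : |e + u| ≤ max e |u| / 2) :
    |ppTrueNumeratorDuu β Λ e u / (e + u) - 2 * ppTrueNumeratorDu β Λ e u / (e + u) ^ 2 + 2 * ppTrueNumerator β Λ e u / (e + u) ^ 3| ≤
      (256 * B₃ + 768 * B₂ + 2496 * B₁ + 1512) * (max e |u|)⁻¹ ^ 3 := by
  have hB0 := salmhoferB₁_nonneg hB₁
  have hB20 : 0 ≤ B₂ := (abs_nonneg _).trans (hB₂ 0)
  have hB30 : 0 ≤ B₃ := (abs_nonneg _).trans (hB₃ 0)
  set M : ℝ := max e |u| with hM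
  have hM0 : 0 < M := he.trans_le (le_max_left _ _)
  have hseg := segment_scale_of_near_antidiag he hsmall
  set C : ℝ := (256 * B₃ + 768 * B₂ + 2496 * B₁ + 1512) / M ^ 3 with hC
  have hC0 : 0 ≤ C := by positivity
  -- `ψ₂(v) = ∂ᵤ²N(e+v)² − 2∂ᵤN(e+v) + 2N`, `ψ₂(−e) = 0`, `ψ₂′(v) = ∂ᵤ³N(e,v)(e+v)²`
  set ψ : ℝ → ℝ := fun v => ppTrueNumeratorDuu β Λ e v * (e + v) ^ 2 - 2 * ppTrueNumeratorDu β Λ e v * (e + v) + 2 * ppTrueNumerator β Λ e v with hψ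
  have hψ0 : ψ (-e) = 0 := by simp only [hψ]; rw [ppTrueNumerator_antidiag]; ring
  have hψd : ∀ v, HasDerivAt ψ (ppTrueNumeratorDuuu β Λ e v * (e + v) ^ 2) v := fun v => by
    have h1 := hasDerivAt_ppTrueNumeratorDuu_u hβ hΛ hB₁ hB₂ hB₃ e v
    have h2 : HasDerivAt (fun w : ℝ => e + w) 1 v := (hasDerivAt_id v).const_add e
    have h22 : HasDerivAt (fun w : ℝ => (e + w) ^ 2) (2 * (e + v) * 1) v := by
      have h0 := h2.pow 2
      refine h0.congr_deriv ?_
      simp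
    have h3 := hasDerivAt_ppTrueNumeratorDu_u hβ hΛ hB₁ hB₂ e v
    have h4 := hasDerivAt_ppTrueNumerator_u hβ hΛ hB₁ e v
    have h := ((h1.fun_mul h22).fun_sub ((h3.fun_mul h2).const_mul 2)).fun_add (h4.const_mul 2)
    refine (h.congr_of_eventuallyEq (Eventually.of_forall fun w => by simp only [hψ]; ring)).congr_deriv ?_
    ring
  -- on the segment `|ψ₂′(v)| ≤ C·(e+u)²`
  have hbd : ∀ v ∈ uIcc (-e) u, ‖ppTrueNumeratorDuuu β Λ e v * (e + v) ^ 2‖ ≤ C * (e + u) ^ 2 := fun v hv => by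
    rw [Real.norm_eq_abs, abs_mul, abs_pow]
    have h1 := abs_ppTrueNumeratorDuuu_le_of_scale hβ hΛ hB₁ hB₂ hB₃ hM0 (hseg v hv) e
    have h2 : |e + v| ≤ |e + u| := by
      have := Set.abs_sub_left_of_mem_uIcc hv
      rw [show v - -e = e + v by ring, show u - -e = e + u by ring] at this
      exact this
    have h3 : |e + v| ^ 2 ≤ (e + u) ^ 2 := by rw [← sq_abs (e + u)]; exact pow_le_pow_left₀ (abs_nonneg _) h2 2
    exact mul_le_mul h1 h3 (by positivity) hC0
  have hMVT := Convex.norm_image_sub_le_of_norm_hasDerivWithin_le (f := ψ) (fun v _ => (hψd v).hasDerivWithinAt) hbd (convex_uIcc _ _)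
    left_mem_uIcc right_mem_uIcc
  rw [hψ0, sub_zero, Real.norm_eq_abs, Real.norm_eq_abs, show u - -e = e + u by ring] at hMVT
  -- `K″ = ψ₂(u)/(e+u)³`
  have hK : ppTrueNumeratorDuu β Λ e u / (e + u) - 2 * ppTrueNumeratorDu β Λ e u / (e + u) ^ 2 + 2 * ppTrueNumerator β Λ e u / (e + u) ^ 3 =
      ψ u / (e + u) ^ 3 := by
    simp only [hψ]; field_simp
  have hs3 : 0 < |e + u| ^ 3 := by positivity
  rw [hK, abs_div, abs_pow, div_le_iff₀ hs3]
  calc |ψ u| ≤ C * (e + u) ^ 2 * |e + u| := hMVT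
    _ = C * |e + u| ^ 3 := by rw [← sq_abs (e + u)]; ring
    _ = (256 * B₃ + 768 * B₂ + 2496 * B₁ + 1512) * M⁻¹ ^ 3 * |e + u| ^ 3 := by rw [hC, inv_pow, div_eq_mul_inv]

/-! ## §3 Away from the anti-diagonal: on a support condition -/

/-- **THE SIGNED SECOND-DERIVATIVE ENVELOPE AWAY FROM `u = −e`** (`max(e,|u|)/2 ≤ |e+u|`, support `c·e ≤ |u|`, `0 < c ≤ 1`):
`|K″(u)| ≤ ((32B₂+48B₁+66)/c² + (48B₁+36)/c + 16)·(max e |u|)⁻¹³`. [cite: BenfattoGiulianiMastropietro2006, §2.4 (2.36)] -/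
theorem abs_trueKernelDuu_signed_far_le {β Λ : ℝ} (hβ : 0 < β) (hΛ : 0 < Λ) {B₁ B₂ : ℝ} (hB₁ : ∀ x, |deriv salmhoferCutoff x| ≤ B₁)
    (hB₂ : ∀ x, |deriv (deriv salmhoferCutoff) x| ≤ B₂) {c e u : ℝ} (hc : 0 < c) (hc1 : c ≤ 1) (he : 0 < e) (hsupp : c * e ≤ |u|) (hbig : max e |u| / 2 ≤ |e + u|) :
    |ppTrueNumeratorDuu β Λ e u / (e + u) - 2 * ppTrueNumeratorDu β Λ e u / (e + u) ^ 2 + 2 * ppTrueNumerator β Λ e u / (e + u) ^ 3| ≤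
      ((32 * B₂ + 48 * B₁ + 66) / c ^ 2 + (48 * B₁ + 36) / c + 16) * (max e |u|)⁻¹ ^ 3 := by
  have hB0 := salmhoferB₁_nonneg hB₁
  have hB20 : 0 ≤ B₂ := (abs_nonneg _).trans (hB₂ 0)
  set M : ℝ := max e |u| with hM
  have hM0 : 0 < M := he.trans_le (le_max_left _ _)
  have hs0 : 0 < |e + u| := (by positivity : 0 < M / 2).trans_le hbig
  have hinv : 1 / |e + u| ≤ 2 / M := by rw [div_le_div_iff₀ hs0 hM0]; linarith
  have huM : c * M ≤ |u| := by
    rcases le_total e |u| with h | h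
    · rw [hM, max_eq_right h]; nlinarith [abs_nonneg u]
    · rw [hM, max_eq_left h]; exact hsupp
  -- `|∂ᵤ²N| ≤ C₂/(2cM)²` (scale `2cM ≤ 2|u|`)
  have hDuu : |ppTrueNumeratorDuu β Λ e u| ≤ (64 * B₂ + 96 * B₁ + 132) / (2 * c * M) ^ 2 :=
    abs_ppTrueNumeratorDuu_le_of_scale hβ hΛ hB₁ hB₂ (by positivity) (by linarith) e
  have hDu := abs_ppTrueNumeratorDu_le_of_support hβ hΛ hB₁ hc hc1 he hsupp
  have hN := abs_ppTrueNumerator_le_one hβ Λ e u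
  have hA : |ppTrueNumeratorDuu β Λ e u / (e + u)| ≤ (64 * B₂ + 96 * B₁ + 132) / (2 * c * M) ^ 2 * (2 / M) := by
    rw [abs_div, div_eq_mul_one_div]
    exact mul_le_mul hDuu hinv (by positivity) (by positivity)
  have hB : |2 * ppTrueNumeratorDu β Λ e u / (e + u) ^ 2| ≤ 2 * ((6 * B₁ + 9 / 2) / (c * M)) * (2 / M) ^ 2 := by
    rw [abs_div, abs_mul, abs_of_pos (by norm_num : (0 : ℝ) < 2), abs_pow, div_eq_mul_one_div, ← one_div_pow]
    exact mul_le_mul (mul_le_mul_of_nonneg_left hDu (by norm_num)) (pow_le_pow_left₀ (by positivity) hinv 2) (by positivity) (by positivity)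
  have hCc : |2 * ppTrueNumerator β Λ e u / (e + u) ^ 3| ≤ 2 * 1 * (2 / M) ^ 3 := by
    rw [abs_div, abs_mul, abs_of_pos (by norm_num : (0 : ℝ) < 2), abs_pow, div_eq_mul_one_div, ← one_div_pow]
    exact mul_le_mul (mul_le_mul_of_nonneg_left hN (by norm_num)) (pow_le_pow_left₀ (by positivity) hinv 3) (by positivity) (by positivity)
  refine ((abs_add_le _ _).trans (add_le_add ((abs_sub _ _).trans (add_le_add hA hB)) hCc)).trans (le_of_eq ?_)
  rw [inv_pow]
  field_simp
  ring

/-! ## §4 Both regimes -/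

/-- **`hK2` FOR THE SIGNED TRUE KERNEL ON A SUPPORT CONDITION.**  `0 < c ≤ 1`; `0 < e`, `e + u ≠ 0`, `c·e ≤ |u|`:
`|∂ᵤ²[N(e,u)/(e+u)]| ≤ (256B₃+768B₂+2496B₁+1528 + (32B₂+48B₁+66)/c² + (48B₁+36)/c)·(max e |u|)⁻¹³`. [cite: BenfattoGiulianiMastropietro2006, §2.4 (2.36)] -/
theorem abs_trueKernelDuu_signed_le_inv_max_cube {β Λ : ℝ} (hβ : 0 < β) (hΛ : 0 < Λ) {B₁ B₂ B₃ : ℝ} (hB₁ : ∀ x, |deriv salmhoferCutoff x| ≤ B₁)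
    (hB₂ : ∀ x, |deriv (deriv salmhoferCutoff) x| ≤ B₂) (hB₃ : ∀ x, |deriv (deriv (deriv salmhoferCutoff)) x| ≤ B₃) {c e u : ℝ} (hc : 0 < c) (hc1 : c ≤ 1)
    (he : 0 < e) (hs : e + u ≠ 0) (hsupp : c * e ≤ |u|) :
    |ppTrueNumeratorDuu β Λ e u / (e + u) - 2 * ppTrueNumeratorDu β Λ e u / (e + u) ^ 2 + 2 * ppTrueNumerator β Λ e u / (e + u) ^ 3| ≤
      (256 * B₃ + 768 * B₂ + 2496 * B₁ + 1528 + (32 * B₂ + 48 * B₁ + 66) / c ^ 2 + (48 * B₁ + 36) / c) * (max e |u|)⁻¹ ^ 3 := by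
  have hB0 := salmhoferB₁_nonneg hB₁
  have hB20 : 0 ≤ B₂ := (abs_nonneg _).trans (hB₂ 0)
  have hB30 : 0 ≤ B₃ := (abs_nonneg _).trans (hB₃ 0)
  have hM0 : 0 < max e |u| := he.trans_le (le_max_left _ _)
  have hI : 0 ≤ (max e |u|)⁻¹ ^ 3 := by positivity
  have h1 : 0 ≤ (32 * B₂ + 48 * B₁ + 66) / c ^ 2 := by positivity
  have h2 : 0 ≤ (48 * B₁ + 36) / c := by positivity
  rcases le_or_gt |e + u| (max e |u| / 2) with hsmall | hbig
  · refine (abs_trueKernelDuu_signed_near_le hβ hΛ hB₁ hB₂ hB₃ he hs hsmall).trans ?_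
    apply mul_le_mul_of_nonneg_right _ hI
    linarith
  · refine (abs_trueKernelDuu_signed_far_le hβ hΛ hB₁ hB₂ hc hc1 he hsupp hbig.le).trans ?_
    apply mul_le_mul_of_nonneg_right _ hI
    linarith

/-! ## §5 Near-shell loop levels: all partner levels, no support condition -/

/-- **First derivative, near-shell loop level, all `u`**: `0 < e ≤ K·Λ`, `1 ≤ K`, `e + u ≠ 0` ⟹
`|∂ᵤ[N/(e+u)]| ≤ (64B₂ + 120B₁ + 158 + (12B₁+5)K)·(max e |u|)⁻¹²` (near: §2 of `…TrueSignedDeriv`; `|u| ≥ e/2`: support `c = ½`; `|u| < e/2`: the uniform gradient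
`|∂ᵤN| ≤ (6B₁+5/2)/Λ ≤ (6B₁+5/2)K/e` and `|N| ≤ 1`). [cite: BenfattoGiulianiMastropietro2006, §2.4 (2.36)] -/
theorem abs_trueKernelDu_signed_le_of_le_mul {β Λ : ℝ} (hβ : 0 < β) (hΛ : 0 < Λ) {B₁ B₂ : ℝ} (hB₁ : ∀ x, |deriv salmhoferCutoff x| ≤ B₁)
    (hB₂ : ∀ x, |deriv (deriv salmhoferCutoff) x| ≤ B₂) {K e u : ℝ} (hK : 1 ≤ K) (he : 0 < e) (heK : e ≤ K * Λ) (hs : e + u ≠ 0) :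
    |ppTrueNumeratorDu β Λ e u / (e + u) - ppTrueNumerator β Λ e u / (e + u) ^ 2| ≤ (64 * B₂ + 120 * B₁ + 158 + (12 * B₁ + 5) * K) * (max e |u|)⁻¹ ^ 2 := by
  have hB0 := salmhoferB₁_nonneg hB₁
  have hB20 : 0 ≤ B₂ := (abs_nonneg _).trans (hB₂ 0)
  set M : ℝ := max e |u| with hM
  have hM0 : 0 < M := he.trans_le (le_max_left _ _)
  have hI : 0 ≤ M⁻¹ ^ 2 := by positivity
  have hK0 : 0 ≤ K := by linarith
  rcases le_or_gt |e + u| (M / 2) with hsmall | hbig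
  · refine (abs_trueKernelDu_signed_near_le hβ hΛ hB₁ hB₂ he hs hsmall).trans ?_
    apply mul_le_mul_of_nonneg_right _ hI
    nlinarith
  rcases le_or_gt (e / 2) |u| with hfar | hnear
  · have hsupp : 1 / 2 * e ≤ |u| := by linarith
    refine (abs_trueKernelDu_signed_far_le hβ hΛ hB₁ (by norm_num) (by norm_num) he hsupp hbig.le).trans ?_
    apply mul_le_mul_of_nonneg_right _ hI
    nlinarith
  · -- `|u| < e/2`: `M = e`, `e + u ≥ e/2`
    have hMe : M = e := by rw [hM, max_eq_left (by linarith)]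
    have hsum : e / 2 ≤ e + u := by linarith [neg_abs_le u]
    have hs0 : 0 < e + u := by linarith
    have hinv : 1 / |e + u| ≤ 2 / e := by rw [abs_of_pos hs0, div_le_div_iff₀ hs0 he]; linarith
    have hDu : |ppTrueNumeratorDu β Λ e u| ≤ (6 * B₁ + 5 / 2) * K / e := by
      refine (abs_ppTrueNumeratorDu_le_unif hβ hΛ hB₁ e u).trans ?_
      rw [div_le_div_iff₀ hΛ he]; nlinarith
    have hN := abs_ppTrueNumerator_le_one hβ Λ e u
    have hA : |ppTrueNumeratorDu β Λ e u / (e + u)| ≤ (6 * B₁ + 5 / 2) * K / e * (2 / e) := by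
      rw [abs_div, div_eq_mul_one_div]; exact mul_le_mul hDu hinv (by positivity) (by positivity)
    have hB : |ppTrueNumerator β Λ e u / (e + u) ^ 2| ≤ 1 * (2 / e) ^ 2 := by
      rw [abs_div, abs_pow, div_eq_mul_one_div, ← one_div_pow]
      exact mul_le_mul hN (pow_le_pow_left₀ (by positivity) hinv 2) (by positivity) zero_le_one
    refine ((abs_sub _ _).trans (add_le_add hA hB)).trans ?_
    rw [hMe, inv_pow, show (6 * B₁ + 5 / 2) * K / e * (2 / e) + 1 * (2 / e) ^ 2 = ((12 * B₁ + 5) * K + 4) * (e ^ 2)⁻¹ by field_simp; ring]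
    apply mul_le_mul_of_nonneg_right _ (by positivity)
    nlinarith

/-- **Second derivative, near-shell loop level, all `u`**: `0 < e ≤ K·Λ`, `1 ≤ K`, `e + u ≠ 0` ⟹
`|∂ᵤ²[N/(e+u)]| ≤ (256B₃+768B₂+2496B₁+1512 + 128B₂+288B₁+368 + (32B₂+48B₁+60)K² + (48B₁+20)K)·(max e |u|)⁻¹³`. [cite: BenfattoGiulianiMastropietro2006, §2.4 (2.36)] -/
theorem abs_trueKernelDuu_signed_le_of_le_mul {β Λ : ℝ} (hβ : 0 < β) (hΛ : 0 < Λ) {B₁ B₂ B₃ : ℝ} (hB₁ : ∀ x, |deriv salmhoferCutoff x| ≤ B₁)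
    (hB₂ : ∀ x, |deriv (deriv salmhoferCutoff) x| ≤ B₂) (hB₃ : ∀ x, |deriv (deriv (deriv salmhoferCutoff)) x| ≤ B₃) {K e u : ℝ} (hK : 1 ≤ K) (he : 0 < e)
    (heK : e ≤ K * Λ) (hs : e + u ≠ 0) :
    |ppTrueNumeratorDuu β Λ e u / (e + u) - 2 * ppTrueNumeratorDu β Λ e u / (e + u) ^ 2 + 2 * ppTrueNumerator β Λ e u / (e + u) ^ 3| ≤
      (256 * B₃ + 768 * B₂ + 2496 * B₁ + 1512 + (128 * B₂ + 288 * B₁ + 368) + (32 * B₂ + 48 * B₁ + 60) * K ^ 2 + (48 * B₁ + 20) * K) * (max e |u|)⁻¹ ^ 3 := by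
  have hB0 := salmhoferB₁_nonneg hB₁
  have hB20 : 0 ≤ B₂ := (abs_nonneg _).trans (hB₂ 0)
  have hB30 : 0 ≤ B₃ := (abs_nonneg _).trans (hB₃ 0)
  set M : ℝ := max e |u| with hM
  have hM0 : 0 < M := he.trans_le (le_max_left _ _)
  have hI : 0 ≤ M⁻¹ ^ 3 := by positivity
  have hK0 : 0 ≤ K := by linarith
  have hK2 : 1 ≤ K ^ 2 := by nlinarith
  rcases le_or_gt |e + u| (M / 2) with hsmall | hbig
  · refine (abs_trueKernelDuu_signed_near_le hβ hΛ hB₁ hB₂ hB₃ he hs hsmall).trans ?_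
    apply mul_le_mul_of_nonneg_right _ hI
    nlinarith
  rcases le_or_gt (e / 2) |u| with hfar | hnear
  · have hsupp : 1 / 2 * e ≤ |u| := by linarith
    refine (abs_trueKernelDuu_signed_far_le hβ hΛ hB₁ hB₂ (by norm_num) (by norm_num) he hsupp hbig.le).trans ?_
    apply mul_le_mul_of_nonneg_right _ hI
    norm_num
    nlinarith
  · -- `|u| < e/2`: `M = e`, `e + u ≥ e/2`
    have hMe : M = e := by rw [hM, max_eq_left (by linarith)]
    have hsum : e / 2 ≤ e + u := by linarith [neg_abs_le u]
    have hs0 : 0 < e + u := by linarith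
    have hinv : 1 / |e + u| ≤ 2 / e := by rw [abs_of_pos hs0, div_le_div_iff₀ hs0 he]; linarith
    have hDuu : |ppTrueNumeratorDuu β Λ e u| ≤ (16 * B₂ + 24 * B₁ + 30) * K ^ 2 / e ^ 2 := by
      refine (abs_ppTrueNumeratorDuu_le_unif hβ hΛ hB₁ hB₂ e u).trans ?_
      rw [div_le_div_iff₀ (by positivity) (by positivity)]
      have : e ^ 2 ≤ K ^ 2 * Λ ^ 2 := by nlinarith
      nlinarith
    have hDu : |ppTrueNumeratorDu β Λ e u| ≤ (6 * B₁ + 5 / 2) * K / e := by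
      refine (abs_ppTrueNumeratorDu_le_unif hβ hΛ hB₁ e u).trans ?_
      rw [div_le_div_iff₀ hΛ he]; nlinarith
    have hN := abs_ppTrueNumerator_le_one hβ Λ e u
    have hA : |ppTrueNumeratorDuu β Λ e u / (e + u)| ≤ (16 * B₂ + 24 * B₁ + 30) * K ^ 2 / e ^ 2 * (2 / e) := by
      rw [abs_div, div_eq_mul_one_div]; exact mul_le_mul hDuu hinv (by positivity) (by positivity)
    have hB : |2 * ppTrueNumeratorDu β Λ e u / (e + u) ^ 2| ≤ 2 * ((6 * B₁ + 5 / 2) * K / e) * (2 / e) ^ 2 := by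
      rw [abs_div, abs_mul, abs_of_pos (by norm_num : (0 : ℝ) < 2), abs_pow, div_eq_mul_one_div, ← one_div_pow]
      exact mul_le_mul (mul_le_mul_of_nonneg_left hDu (by norm_num)) (pow_le_pow_left₀ (by positivity) hinv 2) (by positivity) (by positivity)
    have hCc : |2 * ppTrueNumerator β Λ e u / (e + u) ^ 3| ≤ 2 * 1 * (2 / e) ^ 3 := by
      rw [abs_div, abs_mul, abs_of_pos (by norm_num : (0 : ℝ) < 2), abs_pow, div_eq_mul_one_div, ← one_div_pow]
      exact mul_le_mul (mul_le_mul_of_nonneg_left hN (by norm_num)) (pow_le_pow_left₀ (by positivity) hinv 3) (by positivity) (by positivity)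
    refine ((abs_add_le _ _).trans (add_le_add ((abs_sub _ _).trans (add_le_add hA hB)) hCc)).trans ?_
    rw [hMe, inv_pow, show (16 * B₂ + 24 * B₁ + 30) * K ^ 2 / e ^ 2 * (2 / e) + 2 * ((6 * B₁ + 5 / 2) * K / e) * (2 / e) ^ 2 + 2 * 1 * (2 / e) ^ 3 =
      ((32 * B₂ + 48 * B₁ + 60) * K ^ 2 + (48 * B₁ + 20) * K + 16) * (e ^ 3)⁻¹ by field_simp; ring]
    apply mul_le_mul_of_nonneg_right _ (by positivity)
    nlinarith

end Summit.HubbardSuperconductivity.HubbardSuperconductivity.Theorems.C4a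

end
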